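import Mathlib
import HarnessLib
import Literature.NumberTheory.GaloisRepresentations.GaloisRep
import Literature.NumberTheory.GaloisRepresentations.OrdinaryGaloisRep
import Literature.NumberTheory.GaloisRepresentations.FramedRepTwist
import Literature.NumberTheory.GaloisRepresentations.IntegralGaloisAction
import Literature.NumberTheory.GaloisRepresentations.LocalGaloisGroup
import Summits.Langlands.Langlands.Theorems.SkinnerWilesDefectOneEisensteinProModularSeedRestrictTwistGaloisPackageAux3
import Summits.Langlands.Langlands.Theorems.SkinnerWilesDefectOneEisensteinProModularSeedQuadraticBaseChangeTwistNonDihedral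

/-!
# Stub `stub_twistGaloisTransport` (S7c) of the line `descend-raise-basechange`
# (crux `Summit.Langlands.Langlands.Theses.SkinnerWilesDefectOne.EisensteinProModularSeed`, stmt-Langlands-12920)

**S7c — transport of a Galois package along a finite-order scalar twist.**  `F` a number field, `p` a
prime, `O = 𝒪_{ℚ̄_p}`; `(ρ, ρ₀)` a continuous `Γ_F → GL₂(ℚ̄_p)` with residually upper-triangular
integral model, unramified almost everywhere; `ν : Γ_F → ℚ̄_pˣ` continuous with `ν^n = 1` (`0 < n`);
`ρ₀ = ν · ρ₀'` entrywise (the TWISTED-COUSIN regime of skeleton v5); and `(r', r₀', q, S, k, m)` a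
Galois package for `ρ₀'`: `r'` irreducible with residually upper-triangular integral model `r₀'` of the
ordered residual diagonal of `ρ₀'`, ORIENTED ordinary frames of exponents `(k, m)` at every `v ∣ p`,
`S ⊇ {v ∣ p}` finite with `r'` unramified off `S`, the level clause for `ρ₀'`, and `ν` trivial on the
inertia groups above the residually-unramified places `v ≠ q`, `v ∤ p` of `ρ₀`.  THEN with

* `r := ν ⊗ r'` (`FramedRep.twist r' ν`, `(r σ) = ν(σ) • r'(σ)`, `FramedRep.coe_twist_apply`),
* `r₀ := ν · r₀'` (`RestrictTwist.exists_integral_twist`; `ν` is unit-valued — a root of unity has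
  valuation `1` — so it factors through `Oˣ`),
* `S' := S ∪ {q} ∪ {v : ρ₀ residually ramified at v}`,

`r` is irreducible (`isIrreducible_of_coe_eq_smul` with `φ = id`: `r' = ν⁻¹ • r`), `r₀` is an integral
model of `r` with the ordered residual diagonal of `ρ₀`
(`ν (r₀')ᵢᵢ - (ρ₀)ᵢᵢ = ν ((r₀')ᵢᵢ - (ρ₀')ᵢᵢ) ∈ 𝔪`), the SAME frames `Q` are oriented ordinary for `r`
with exponents `(k, m·n)` (scalars are central: `Q⁻¹ (ν • M) Q = ν • Q⁻¹ M Q`; `(ν θ₂)^{mn} = 1`,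
`(ν θ₁)^{mn} = ε^{(k-1)mn}`), `S'` is finite (`{ρ₀ residually ramified} ⊆ {ρ ramified}`, finite by
hypothesis), `S ⊆ S' ⊇ {v ∣ p}`, `r` and `ν` are unramified off `S'`, and the level clause for `ρ₀`
holds with `S'` (at a residually-unramified `v ≠ q`, `v ∤ p` of `ρ₀`, `ν = 1` on inertia, so `ρ₀'` is
residually unramified there too and `v ∉ S` by the level clause for `ρ₀'`).  Pure frame algebra; the
case `K = F` of the landed `RestrictTwist.orientedOrdinary_twist_restrict` /
`RestrictTwist.isUnramifiedAt_twist_restrict`.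

References: C. Skinner, A. Wiles, *Residually reducible representations and modular forms*, Publ. Math.
IHÉS 89 (1999), §1; J.-P. Serre, *Abelian ℓ-adic representations* (1968), Ch. I §2.1. [folklore]
-/

set_option linter.dupNamespace false -- project-wide option (lakefile weak.linter.dupNamespace); `Summit.Langlands.Langlands` is the mandated namespace

noncomputable section

namespace Summit.Langlands.Langlands.Theorems.SkinnerWilesDefectOne.EisensteinProModularSeed.TwistTransport

open Literature.NumberTheory.GaloisRepresentations
open Summit.Langlands.Langlands.Theorems.EisensteinProModularSeed.Negative (entry_eq_of_integralModel)
open Summit.Langlands.Langlands.Theorems.SkinnerWilesDefectOne.EisensteinProModularSeed.RestrictTwist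
open IsLocalRing Field IsDedekindDomain NumberField Filter
open scoped NumberField Matrix

/-- Conjugating a central twist: `Q⁻¹ (S L) Q = S (Q⁻¹ L Q)` for `S` commuting with `Q⁻¹`. [folklore] -/
theorem conj_scalar_mul {G : Type*} [Group G] (Q S L : G) (hS : Q⁻¹ * S = S * Q⁻¹) :
    Q⁻¹ * (S * L) * Q = S * (Q⁻¹ * L * Q) := by
  calc Q⁻¹ * (S * L) * Q = (Q⁻¹ * S) * L * Q := by group
    _ = (S * Q⁻¹) * L * Q := by rw [hS]
    _ = S * (Q⁻¹ * L * Q) := by group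

variable {F : Type} [Field F] {p : ℕ} [Fact p.Prime] {O : ValuationSubring (PadicAlgCl p)}

/-- A continuous character `ν : Γ_F → ℚ̄_pˣ` of finite exponent is unit-valued: `‖ν(σ)‖ = 1`
(a root of unity has valuation `1`). [folklore] -/
theorem v_eq_one_of_pow_eq_one (ν : absoluteGaloisGroup F →ₜ* (PadicAlgCl p)ˣ) {n : ℕ} (hn : 0 < n)
    (hνn : ∀ σ, ν σ ^ n = 1) (σ : absoluteGaloisGroup F) :
    Valued.v ((ν σ : (PadicAlgCl p)ˣ) : PadicAlgCl p) = 1 := by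
  have h : Valued.v ((ν σ : (PadicAlgCl p)ˣ) : PadicAlgCl p) ^ n = 1 := by
    rw [← map_pow, ← Units.val_pow_eq_pow_val, hνn, Units.val_one, map_one]
  exact (pow_eq_one_iff_of_nonneg zero_le hn.ne').mp h

/-- **A finite-order character factors through `Oˣ`.** For `O = 𝒪_{ℚ̄_p}` and `ν : Γ_F → ℚ̄_pˣ`
continuous with `ν^n = 1`, `0 < n`, there is `ν₀ : Γ_F → Oˣ` with `ν = ν₀` under `O ⊆ ℚ̄_p`.
[folklore] -/
theorem exists_units_lift (hO : O = (Valued.v : Valuation (PadicAlgCl p) NNReal).valuationSubring)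
    (ν : absoluteGaloisGroup F →ₜ* (PadicAlgCl p)ˣ) {n : ℕ} (hn : 0 < n) (hνn : ∀ σ, ν σ ^ n = 1) :
    ∃ ν₀ : absoluteGaloisGroup F →* Oˣ,
      ∀ σ, (((ν₀ σ : Oˣ) : O) : PadicAlgCl p) = ((ν σ : (PadicAlgCl p)ˣ) : PadicAlgCl p) := by
  have hνO : ∀ σ, ((ν σ : (PadicAlgCl p)ˣ) : PadicAlgCl p) ∈ O := fun σ => by
    rw [hO, Valuation.mem_valuationSubring_iff]
    exact (v_eq_one_of_pow_eq_one ν hn hνn σ).le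
  let νO : absoluteGaloisGroup F →* O :=
    { toFun := fun σ => ⟨_, hνO σ⟩
      map_one' := Subtype.ext (by simp)
      map_mul' := fun a b => Subtype.ext (by simp) }
  exact ⟨νO.toHomUnits, fun σ => rfl⟩

end Summit.Langlands.Langlands.Theorems.SkinnerWilesDefectOne.EisensteinProModularSeed.TwistTransport

namespace Summit.Langlands.Langlands.Theorems.SkinnerWilesDefectOne.EisensteinProModularSeed

open Literature.NumberTheory.GaloisRepresentations
open Summit.Langlands.Langlands.Theorems.EisensteinProModularSeed.Negative (entry_eq_of_integralModel)
open Summit.Langlands.Langlands.Theorems.SkinnerWilesDefectOne.EisensteinProModularSeed.RestrictTwist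
open Summit.Langlands.Langlands.Theorems.SkinnerWilesDefectOne.EisensteinProModularSeed.TwistTransport
open IsLocalRing Field IsDedekindDomain NumberField Filter
open scoped NumberField Matrix

/-- **stub_twistGaloisTransport** (line `descend-raise-basechange`, S7c — transport of the Galois package
`(r', r₀', q, S, k, m)` of `ρ₀'` along the finite-order scalar twist `ν` to `ρ₀ = ν · ρ₀'`:
`r := ν ⊗ r'`, `r₀ := ν · r₀'`, same oriented frames with exponents `(k, m·n)`, level set
`S' := S ∪ {q} ∪ {v : ρ₀ residually ramified at v}`; statement = the registered stub of the line skeleton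
v5 in its READABLE spelling (the skeleton's `open`s: `FramedGaloisRep`, `absoluteGaloisGroup`, `HeightOneSpectrum (𝓞 F)`,
`maximalIdeal`, `absInertia`, `GaloisRep.cyclotomicCharacter`, `cofinite`) — it elaborates to the fully-qualified signature of
the skeleton, see `stub_twistGaloisTransport_fq` below, whose proof is this term).  See the module docstring for the
construction. Skinner–Wiles (1999) §1; Serre (1968) Ch. I §2.1. [folklore] -/
theorem stub_twistGaloisTransport :
    ∀ (F : Type) [Field F] [NumberField F] (p : ℕ) [Fact p.Prime] (O : ValuationSubring (PadicAlgCl p)),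
      O = (Valued.v : Valuation (PadicAlgCl p) NNReal).valuationSubring →
      ∀ (ρ : FramedGaloisRep F (PadicAlgCl p) 2)
        (ρ₀ ρ₀' : absoluteGaloisGroup F →* Matrix.GeneralLinearGroup (Fin 2) O)
        (ν : absoluteGaloisGroup F →ₜ* (PadicAlgCl p)ˣ) (n : ℕ),
      (∀ᶠ v in cofinite, ρ.IsUnramifiedAt v) → ρ.HasUpperTriangularIntegralModel ρ₀ →
      0 < n → (∀ σ, ν σ ^ n = 1) →
      (∀ σ (i j : Fin 2), ((ρ₀ σ).val i j : PadicAlgCl p) = ((ν σ : (PadicAlgCl p)ˣ) : PadicAlgCl p) * ((ρ₀' σ).val i j : PadicAlgCl p)) →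
      ∀ (r' : FramedGaloisRep F (PadicAlgCl p) 2)
        (r₀' : absoluteGaloisGroup F →* Matrix.GeneralLinearGroup (Fin 2) O)
        (q : HeightOneSpectrum (𝓞 F))
        (S : Set (HeightOneSpectrum (𝓞 F))) (k m : ℕ),
      r'.toGaloisRep.IsIrreducible → r'.HasUpperTriangularIntegralModel r₀' →
      (∀ g, ((r₀' g).val 0 0 - (ρ₀' g).val 0 0 : O) ∈ maximalIdeal O ∧
        ((r₀' g).val 1 1 - (ρ₀' g).val 1 1 : O) ∈ maximalIdeal O) →
      0 < m →
      (∀ v : HeightOneSpectrum (𝓞 F), (p : 𝓞 F) ∈ v.asIdeal →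
        ∃ Q : Matrix.GeneralLinearGroup (Fin 2) (PadicAlgCl p),
          Valued.v (Q.val 0 0) ≤ Valued.v (Q.val 1 0) ∧
          ∀ σ, (Q⁻¹ * r'.toLocal v σ * Q).val 1 0 = 0 ∧
            (σ ∈ absInertia (v.adicCompletion F) →
              (Q⁻¹ * r'.toLocal v σ * Q).val 1 1 ^ m = 1 ∧
              (Q⁻¹ * r'.toLocal v σ * Q).val 0 0 ^ m =
                algebraMap (Padic p) (PadicAlgCl p)
                  (((GaloisRep.cyclotomicCharacter (v.adicCompletion F) p σ).val : PadicInt p) :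
                    Padic p) ^ ((k - 1) * m))) →
      S.Finite → (∀ v : HeightOneSpectrum (𝓞 F), (p : 𝓞 F) ∈ v.asIdeal → v ∈ S) →
      (∀ v ∉ S, r'.IsUnramifiedAt v) →
      (∀ v : HeightOneSpectrum (𝓞 F), v ≠ q → (p : 𝓞 F) ∉ v.asIdeal →
        (∀ 𝔓 ∈ v.primesAbove, ∀ σ ∈ 𝔓.inertia (absoluteGaloisGroup F),
          ((ρ₀' σ).val 0 0 - 1 : O) ∈ maximalIdeal O ∧ ((ρ₀' σ).val 1 1 - 1 : O) ∈ maximalIdeal O) →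
        v ∉ S) →
      (∀ v : HeightOneSpectrum (𝓞 F), v ≠ q → (p : 𝓞 F) ∉ v.asIdeal →
        (∀ 𝔓 ∈ v.primesAbove, ∀ σ ∈ 𝔓.inertia (absoluteGaloisGroup F),
          ((ρ₀ σ).val 0 0 - 1 : O) ∈ maximalIdeal O ∧ ((ρ₀ σ).val 1 1 - 1 : O) ∈ maximalIdeal O) →
        ∀ 𝔓 ∈ v.primesAbove, ∀ σ ∈ 𝔓.inertia (absoluteGaloisGroup F), ν σ = 1) →
      ∃ (r : FramedGaloisRep F (PadicAlgCl p) 2)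
        (r₀ : absoluteGaloisGroup F →* Matrix.GeneralLinearGroup (Fin 2) O)
        (S' : Set (HeightOneSpectrum (𝓞 F))),
        (∀ σ, (r σ).val = ((ν σ : (PadicAlgCl p)ˣ) : PadicAlgCl p) • (r' σ).val) ∧
        r.toGaloisRep.IsIrreducible ∧ r.HasUpperTriangularIntegralModel r₀ ∧
        (∀ g, ((r₀ g).val 0 0 - (ρ₀ g).val 0 0 : O) ∈ maximalIdeal O ∧
          ((r₀ g).val 1 1 - (ρ₀ g).val 1 1 : O) ∈ maximalIdeal O) ∧
        (∀ v : HeightOneSpectrum (𝓞 F), (p : 𝓞 F) ∈ v.asIdeal →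
          ∃ Q : Matrix.GeneralLinearGroup (Fin 2) (PadicAlgCl p),
            Valued.v (Q.val 0 0) ≤ Valued.v (Q.val 1 0) ∧
            ∀ σ, (Q⁻¹ * r.toLocal v σ * Q).val 1 0 = 0 ∧
              (σ ∈ absInertia (v.adicCompletion F) →
                (Q⁻¹ * r.toLocal v σ * Q).val 1 1 ^ (m * n) = 1 ∧
                (Q⁻¹ * r.toLocal v σ * Q).val 0 0 ^ (m * n) =
                  algebraMap (Padic p) (PadicAlgCl p)
                    (((GaloisRep.cyclotomicCharacter (v.adicCompletion F) p σ).val : PadicInt p) :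
                      Padic p) ^ ((k - 1) * (m * n)))) ∧
        S'.Finite ∧ S ⊆ S' ∧
        (∀ v : HeightOneSpectrum (𝓞 F), (p : 𝓞 F) ∈ v.asIdeal → v ∈ S') ∧
        (∀ v ∉ S', r.IsUnramifiedAt v) ∧
        (∀ v ∉ S', ∀ 𝔓 ∈ v.primesAbove, ∀ σ ∈ 𝔓.inertia (absoluteGaloisGroup F), ν σ = 1) ∧
        (∀ v : HeightOneSpectrum (𝓞 F), v ≠ q → (p : 𝓞 F) ∉ v.asIdeal →
          (∀ 𝔓 ∈ v.primesAbove, ∀ σ ∈ 𝔓.inertia (absoluteGaloisGroup F),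
            ((ρ₀ σ).val 0 0 - 1 : O) ∈ maximalIdeal O ∧ ((ρ₀ σ).val 1 1 - 1 : O) ∈ maximalIdeal O) →
          v ∉ S') := by
  intro F _ _ p _ O hO ρ ρ₀ ρ₀' ν n hunr hmod hn hνn hνρ r' r₀' q S k m hirr hmod' hdiag hm hord hSfin
    hpS hunr' hlev hνunr
  classical
  -- `ν` factors through `Oˣ`; the twist `r = ν ⊗ r'` and its integral model `r₀ = ν · r₀'`
  obtain ⟨ν₀, hν₀⟩ := exists_units_lift hO ν hn hνn
  obtain ⟨r₀, hr₀⟩ := exists_integral_twist r₀' ν₀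
  set r : FramedGaloisRep F (PadicAlgCl p) 2 := FramedRep.twist r' ν with hr_def
  have hr : ∀ σ, r σ = FramedRep.scalar (PadicAlgCl p) 2 (ν σ) * r' σ := fun σ => rfl
  have hcoe : ∀ σ, (r σ).val = ((ν σ : (PadicAlgCl p)ˣ) : PadicAlgCl p) • (r' σ).val := fun σ =>
    FramedRep.coe_twist_apply _ _ σ
  have hr₀' : ∀ g (i j : Fin 2), (r₀ g).val i j = (ν₀ g : O) * (r₀' g).val i j := fun g i j => by
    rw [hr₀ g, scalar_mul_val_apply]
  have hρ₀' : ∀ g (i j : Fin 2), (ρ₀ g).val i j = (ν₀ g : O) * (ρ₀' g).val i j := fun g i j =>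
    Subtype.ext (by push_cast; rw [hν₀]; exact hνρ g i j)
  -- `r₀` is a residually upper-triangular integral model of `r`, with the diagonal of `ρ₀`
  have hmodr : r.HasUpperTriangularIntegralModel r₀ := by
    refine ⟨fun g => Units.ext (Matrix.ext fun i j => ?_),
      (isResiduallyUpperTriangular_two_iff r₀).mpr fun g => ?_⟩
    · change O.subtype ((r₀ g).val i j) = (r g).val i j
      rw [hr, hr₀', scalar_mul_val_apply, map_mul, entry_eq_of_integralModel hmod' _ i j, ← hν₀]
      rfl
    · rw [hr₀']
      exact Ideal.mul_mem_left _ _ ((isResiduallyUpperTriangular_two_iff _).mp hmod'.2 _)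
  have hdiagr : ∀ g, ((r₀ g).val 0 0 - (ρ₀ g).val 0 0 : O) ∈ maximalIdeal O ∧
      ((r₀ g).val 1 1 - (ρ₀ g).val 1 1 : O) ∈ maximalIdeal O := fun g => by
    obtain ⟨ha, hd⟩ := hdiag g
    rw [hr₀', hr₀', hρ₀' g 0 0, hρ₀' g 1 1, ← mul_sub, ← mul_sub]
    exact ⟨Ideal.mul_mem_left _ _ ha, Ideal.mul_mem_left _ _ hd⟩
  -- the residual unramifiedness clause of `ρ₀` and the level set `S'`
  set S' : Set (HeightOneSpectrum (𝓞 F)) :=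
    S ∪ {q} ∪
      {v | ¬ ∀ 𝔓 ∈ v.primesAbove, ∀ σ ∈ 𝔓.inertia (absoluteGaloisGroup F),
        ((ρ₀ σ).val 0 0 - 1 : O) ∈ maximalIdeal O ∧ ((ρ₀ σ).val 1 1 - 1 : O) ∈ maximalIdeal O}
    with hS'
  -- unpacking `v ∉ S'`
  have hout : ∀ v ∉ S', v ∉ S ∧ v ≠ q ∧ (p : 𝓞 F) ∉ v.asIdeal ∧
      ∀ 𝔓 ∈ v.primesAbove, ∀ σ ∈ 𝔓.inertia (absoluteGaloisGroup F),
        ((ρ₀ σ).val 0 0 - 1 : O) ∈ maximalIdeal O ∧ ((ρ₀ σ).val 1 1 - 1 : O) ∈ maximalIdeal O := by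
    intro v hvS'
    have hvS : v ∉ S := fun h => hvS' (Set.mem_union_left _ (Set.mem_union_left _ h))
    refine ⟨hvS, fun h => hvS' (Set.mem_union_left _ (Set.mem_union_right _ h)),
      fun h => hvS (hpS v h), ?_⟩
    by_contra h
    exact hvS' (Set.mem_union_right _ h)
  refine ⟨r, r₀, S', hcoe, ?_, hmodr, hdiagr, fun v hv => ?_, ?_,
    fun v hv => Set.mem_union_left _ (Set.mem_union_left _ hv),
    fun v hv => Set.mem_union_left _ (Set.mem_union_left _ (hpS v hv)), fun v hvS' 𝔓 h𝔓 σ hσ => ?_,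
    fun v hvS' 𝔓 h𝔓 σ hσ => ?_, fun v hvq hpv hres hvS' => ?_⟩
  · -- irreducibility passes along `r' = ν⁻¹ • r`
    refine isIrreducible_of_coe_eq_smul r' r id
      (fun σ => (((ν σ)⁻¹ : (PadicAlgCl p)ˣ) : PadicAlgCl p)) (fun σ => ?_) hirr
    rw [id, hcoe, smul_smul, Units.inv_mul, one_smul]
  · -- oriented ordinarity at `v ∣ p`: the same frame `Q`, exponent `m · n`
    obtain ⟨Q, hQ, hQσ⟩ := hord v hv
    refine ⟨Q, hQ, fun σ => ?_⟩
    have key : Q⁻¹ * r.toLocal v σ * Q =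
        FramedRep.scalar (PadicAlgCl p) 2 (ν (absGaloisRestrict F (v.adicCompletion F) σ)) *
          (Q⁻¹ * r'.toLocal v σ * Q) := by
      rw [FramedGaloisRep.toLocal_apply, hr, FramedGaloisRep.toLocal_apply]
      exact conj_scalar_mul Q _ _ (FramedRep.scalar_mul_comm _ Q⁻¹).symm
    have hc : (((ν (absGaloisRestrict F (v.adicCompletion F) σ)) : (PadicAlgCl p)ˣ) :
        PadicAlgCl p) ^ (m * n) = 1 := by
      rw [mul_comm, pow_mul, ← Units.val_pow_eq_pow_val, hνn, Units.val_one, one_pow]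
    refine ⟨?_, fun hσI => ?_⟩
    · rw [key, scalar_mul_val_apply, (hQσ σ).1, mul_zero]
    · obtain ⟨h11, h00⟩ := (hQσ σ).2 hσI
      refine ⟨?_, ?_⟩
      · rw [key, scalar_mul_val_apply, mul_pow, hc, one_mul, pow_mul, h11, one_pow]
      · rw [key, scalar_mul_val_apply, mul_pow, hc, one_mul, pow_mul, h00, ← pow_mul, mul_assoc]
  · -- `S'` is finite: `{ρ₀ residually ramified} ⊆ {ρ ramified}`
    have h3 : {v : HeightOneSpectrum (𝓞 F) | ¬ ∀ 𝔓 ∈ v.primesAbove,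
        ∀ σ ∈ 𝔓.inertia (absoluteGaloisGroup F), ((ρ₀ σ).val 0 0 - 1 : O) ∈ maximalIdeal O ∧
          ((ρ₀ σ).val 1 1 - 1 : O) ∈ maximalIdeal O}.Finite := by
      refine (Filter.eventually_cofinite.mp hunr).subset fun v hv hunrv => hv fun 𝔓 h𝔓 σ hσ => ?_
      have e : ∀ i, (ρ₀ σ).val i i = 1 := fun i => by
        apply Subtype.ext
        rw [← entry_eq_of_integralModel hmod σ i i, hunrv 𝔓 h𝔓 σ hσ]
        simp
      rw [e 0, e 1, sub_self]
      exact ⟨zero_mem _, zero_mem _⟩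
    exact (hSfin.union (Set.finite_singleton q)).union h3
  · -- `r` is unramified outside `S'`
    obtain ⟨hvS, hvq, hpv, hres⟩ := hout v hvS'
    rw [hr, hνunr v hvq hpv hres 𝔓 h𝔓 σ hσ, map_one, one_mul]
    exact hunr' v hvS 𝔓 h𝔓 σ hσ
  · -- `ν` is unramified outside `S'`
    obtain ⟨-, hvq, hpv, hres⟩ := hout v hvS'
    exact hνunr v hvq hpv hres 𝔓 h𝔓 σ hσ
  · -- the level clause for `ρ₀` with `S'`
    rcases hvS' with (hv | hv) | hv
    · refine hlev v hvq hpv (fun 𝔓 h𝔓 σ hσ => ?_) hv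
      have h1 : ν σ = 1 := hνunr v hvq hpv hres 𝔓 h𝔓 σ hσ
      have e : ∀ i, (ρ₀' σ).val i i = (ρ₀ σ).val i i := fun i =>
        Subtype.ext (by rw [hνρ σ i i, h1, Units.val_one, one_mul])
      rw [e 0, e 1]
      exact hres 𝔓 h𝔓 σ hσ
    · exact hvq hv
    · exact hv hres


/-- The registered stub in its FULLY QUALIFIED spelling (lines 1002–1063 of the line skeleton v5, verbatim):
definitionally the statement of `stub_twistGaloisTransport` (the proof is that term). [folklore] -/
theorem stub_twistGaloisTransport_fq :
    ∀ (F : Type) [Field F] [NumberField F] (p : ℕ) [Fact p.Prime] (O : ValuationSubring (PadicAlgCl p)),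
      O = (Valued.v : Valuation (PadicAlgCl p) NNReal).valuationSubring →
      ∀ (ρ : Literature.NumberTheory.GaloisRepresentations.FramedGaloisRep F (PadicAlgCl p) 2)
        (ρ₀ ρ₀' : Field.absoluteGaloisGroup F →* Matrix.GeneralLinearGroup (Fin 2) O)
        (ν : Field.absoluteGaloisGroup F →ₜ* (PadicAlgCl p)ˣ) (n : ℕ),
      (∀ᶠ v in Filter.cofinite, ρ.IsUnramifiedAt v) → ρ.HasUpperTriangularIntegralModel ρ₀ →
      0 < n → (∀ σ, ν σ ^ n = 1) →
      (∀ σ (i j : Fin 2), ((ρ₀ σ).val i j : PadicAlgCl p) = ((ν σ : (PadicAlgCl p)ˣ) : PadicAlgCl p) * ((ρ₀' σ).val i j : PadicAlgCl p)) →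
      ∀ (r' : Literature.NumberTheory.GaloisRepresentations.FramedGaloisRep F (PadicAlgCl p) 2)
        (r₀' : Field.absoluteGaloisGroup F →* Matrix.GeneralLinearGroup (Fin 2) O)
        (q : IsDedekindDomain.HeightOneSpectrum (NumberField.RingOfIntegers F))
        (S : Set (IsDedekindDomain.HeightOneSpectrum (NumberField.RingOfIntegers F))) (k m : ℕ),
      r'.toGaloisRep.IsIrreducible → r'.HasUpperTriangularIntegralModel r₀' →
      (∀ g, ((r₀' g).val 0 0 - (ρ₀' g).val 0 0 : O) ∈ IsLocalRing.maximalIdeal O ∧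
        ((r₀' g).val 1 1 - (ρ₀' g).val 1 1 : O) ∈ IsLocalRing.maximalIdeal O) →
      0 < m →
      (∀ v : IsDedekindDomain.HeightOneSpectrum (NumberField.RingOfIntegers F), (p : NumberField.RingOfIntegers F) ∈ v.asIdeal →
        ∃ Q : Matrix.GeneralLinearGroup (Fin 2) (PadicAlgCl p),
          Valued.v (Q.val 0 0) ≤ Valued.v (Q.val 1 0) ∧
          ∀ σ, (Q⁻¹ * r'.toLocal v σ * Q).val 1 0 = 0 ∧
            (σ ∈ Literature.NumberTheory.GaloisRepresentations.absInertia (v.adicCompletion F) →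
              (Q⁻¹ * r'.toLocal v σ * Q).val 1 1 ^ m = 1 ∧
              (Q⁻¹ * r'.toLocal v σ * Q).val 0 0 ^ m =
                algebraMap (Padic p) (PadicAlgCl p)
                  (((Literature.NumberTheory.GaloisRepresentations.GaloisRep.cyclotomicCharacter (v.adicCompletion F) p σ).val : PadicInt p) :
                    Padic p) ^ ((k - 1) * m))) →
      S.Finite → (∀ v : IsDedekindDomain.HeightOneSpectrum (NumberField.RingOfIntegers F), (p : NumberField.RingOfIntegers F) ∈ v.asIdeal → v ∈ S) →
      (∀ v ∉ S, r'.IsUnramifiedAt v) →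
      (∀ v : IsDedekindDomain.HeightOneSpectrum (NumberField.RingOfIntegers F), v ≠ q → (p : NumberField.RingOfIntegers F) ∉ v.asIdeal →
        (∀ 𝔓 ∈ v.primesAbove, ∀ σ ∈ 𝔓.inertia (Field.absoluteGaloisGroup F),
          ((ρ₀' σ).val 0 0 - 1 : O) ∈ IsLocalRing.maximalIdeal O ∧ ((ρ₀' σ).val 1 1 - 1 : O) ∈ IsLocalRing.maximalIdeal O) →
        v ∉ S) →
      (∀ v : IsDedekindDomain.HeightOneSpectrum (NumberField.RingOfIntegers F), v ≠ q → (p : NumberField.RingOfIntegers F) ∉ v.asIdeal →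
        (∀ 𝔓 ∈ v.primesAbove, ∀ σ ∈ 𝔓.inertia (Field.absoluteGaloisGroup F),
          ((ρ₀ σ).val 0 0 - 1 : O) ∈ IsLocalRing.maximalIdeal O ∧ ((ρ₀ σ).val 1 1 - 1 : O) ∈ IsLocalRing.maximalIdeal O) →
        ∀ 𝔓 ∈ v.primesAbove, ∀ σ ∈ 𝔓.inertia (Field.absoluteGaloisGroup F), ν σ = 1) →
      ∃ (r : Literature.NumberTheory.GaloisRepresentations.FramedGaloisRep F (PadicAlgCl p) 2)
        (r₀ : Field.absoluteGaloisGroup F →* Matrix.GeneralLinearGroup (Fin 2) O)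
        (S' : Set (IsDedekindDomain.HeightOneSpectrum (NumberField.RingOfIntegers F))),
        (∀ σ, (r σ).val = ((ν σ : (PadicAlgCl p)ˣ) : PadicAlgCl p) • (r' σ).val) ∧
        r.toGaloisRep.IsIrreducible ∧ r.HasUpperTriangularIntegralModel r₀ ∧
        (∀ g, ((r₀ g).val 0 0 - (ρ₀ g).val 0 0 : O) ∈ IsLocalRing.maximalIdeal O ∧
          ((r₀ g).val 1 1 - (ρ₀ g).val 1 1 : O) ∈ IsLocalRing.maximalIdeal O) ∧
        (∀ v : IsDedekindDomain.HeightOneSpectrum (NumberField.RingOfIntegers F), (p : NumberField.RingOfIntegers F) ∈ v.asIdeal →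
          ∃ Q : Matrix.GeneralLinearGroup (Fin 2) (PadicAlgCl p),
            Valued.v (Q.val 0 0) ≤ Valued.v (Q.val 1 0) ∧
            ∀ σ, (Q⁻¹ * r.toLocal v σ * Q).val 1 0 = 0 ∧
              (σ ∈ Literature.NumberTheory.GaloisRepresentations.absInertia (v.adicCompletion F) →
                (Q⁻¹ * r.toLocal v σ * Q).val 1 1 ^ (m * n) = 1 ∧
                (Q⁻¹ * r.toLocal v σ * Q).val 0 0 ^ (m * n) =
                  algebraMap (Padic p) (PadicAlgCl p)
                    (((Literature.NumberTheory.GaloisRepresentations.GaloisRep.cyclotomicCharacter (v.adicCompletion F) p σ).val : PadicInt p) :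
                      Padic p) ^ ((k - 1) * (m * n)))) ∧
        S'.Finite ∧ S ⊆ S' ∧
        (∀ v : IsDedekindDomain.HeightOneSpectrum (NumberField.RingOfIntegers F), (p : NumberField.RingOfIntegers F) ∈ v.asIdeal → v ∈ S') ∧
        (∀ v ∉ S', r.IsUnramifiedAt v) ∧
        (∀ v ∉ S', ∀ 𝔓 ∈ v.primesAbove, ∀ σ ∈ 𝔓.inertia (Field.absoluteGaloisGroup F), ν σ = 1) ∧
        (∀ v : IsDedekindDomain.HeightOneSpectrum (NumberField.RingOfIntegers F), v ≠ q → (p : NumberField.RingOfIntegers F) ∉ v.asIdeal →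
          (∀ 𝔓 ∈ v.primesAbove, ∀ σ ∈ 𝔓.inertia (Field.absoluteGaloisGroup F),
            ((ρ₀ σ).val 0 0 - 1 : O) ∈ IsLocalRing.maximalIdeal O ∧ ((ρ₀ σ).val 1 1 - 1 : O) ∈ IsLocalRing.maximalIdeal O) →
          v ∉ S') :=
  stub_twistGaloisTransport

end Summit.Langlands.Langlands.Theorems.SkinnerWilesDefectOne.EisensteinProModularSeed

end
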